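import Mathlib
import Literature.AlgebraicGeometry.Resolution.TranscendenceDefect
import Literature.AlgebraicGeometry.Resolution.LocalBlowup
import Literature.AlgebraicGeometry.Resolution.AbhyankarMonomialUniformization
import Summits.ResolutionOfSingularities.ResolutionOfSingularities.Theorems.RadicialJungCleanModelsLocalMonomializationOfKnafKuhlmann
import HarnessLib

/-!
# Route `RadicialJung`, crux `CleanModels` (stmt-15917), line `Sketch` rev 35, stub 7 `stub_cleanModelsDimGEFour`: local monomialization DESCENDS
# ALONG THE GROUND FIELD — a model over a subfield `k₀ ⊆ k` with `k/k₀` finitely generated is a model over `k` with the SAME local ring at the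
# centre; hence the Abhyankar column of `hMono_d` for places with INSEPARABLE residue field over `k` but separably generated residue field over `k₀`

Explicit-unit seat `decomp-res-hand-2` g3 (structural hand, stubs 5–7).  OURS; nothing here proves resolution in characteristic `p`.

`…LocalMonomializationSplitAbhyankar.lean` (this seat, ✓) leaves, inside the local-uniformization input `hMonoRes_d` of stub 7, the corner
«`O` Abhyankar over `k` with `κ(O)/k` INSEPARABLE» (imperfect `k` only), which Knaf–Kuhlmann 2005 Thm. 1.1 over `k` does not cover.  Observation
(this file): the corner is covered by the SAME printed theorem applied over a smaller ground field.  If `k` is a finitely generated field extension of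
a subfield `k₀` (e.g. `k = 𝔽_p(t₁,…,t_m)` over `k₀ = 𝔽_p`), then `K/k₀` is again finitely generated, `O` is `k₀`-trivial, Abhyankar over `k₀` iff
over `k` (both transcendence degrees grow by `tr.deg k/k₀`), and `κ(O)/k₀` may be separably generated although `κ(O)/k` is not (always, if `k₀` is
perfect: Cor. 2.2 + every finitely generated extension of a perfect field is separably generated).  A `k₀`-model `A₀' ⊆ O` on which `Z` is monomial
becomes the `k`-model `A' := k[A₀']`, and — the one point to check — `(A')_{𝔪_O ∩ A'} = (A₀')_{𝔪_O ∩ A₀'}` as subrings of `K`, because the constants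
`c ∈ k = k₀(T)` are quotients of elements of `k₀[T] ⊆ A₀'` by elements of value `1` (`O ⊇ k`).  So regularity, the regular system of parameters and the
monomials are literally the same.

* `KnafKuhlmann2005_Thm11_monomialFormSepGen` — NAMED FACT (inline, `[cite]`d; the gate relocates it next to `KnafKuhlmann2005_Thm11_monomialForm`):
  Knaf–Kuhlmann 2005 Thm. 1.1 with its monomiality clause in the GENERAL printed form — residue field extension SEPARABLY GENERATED (a finite separating
  transcendence basis), not only separable algebraic; this is the `TODO(general form)` recorded in the docstring of `…_monomialForm` (✓ p793207).
* `knafKuhlmann2005_monomialForm_of_monomialFormSepGen` — PROVED: the general form implies the special form `…_monomialForm` (empty basis).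
* `localMonomialization_of_groundField_descent` — PROVED, the transfer: a finitely generated `k₀`-model `A₀' ⊆ O` containing `k`-algebra generators
  `S` of `A` and field generators `T` of `k/k₀`, regular at the centre of `O` with `Z` monomial there ⟹ the `hMono` conclusion for `A` over `k`
  (model `k[A₀']`, same local ring: `locAtCentre_eq_of_le_of_le`).
* `localMonomialization_at_abhyankarPlace_of_subfield` — `hMono` at `O` for a `k`-model `A`, GIVEN the general fact over `k₀`, `k = k₀(T)`,
  `O` Abhyankar over `k₀` with `κ(O)/k₀` separably generated (hypotheses stated over `k₀`; deriving them from the `k`-data for `k₀` perfect is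
  Knaf–Kuhlmann Cor. 2.2 + `exists_isTranscendenceBasis_and_isSeparable_of_perfectField` + `Algebra.trdeg_add_eq`, not done here).

Census consequence: over ground fields finitely generated over a perfect field, the residual local-uniformization input of stub 7 is `hMono_d` at
NON-ABHYANKAR zero-dimensional valuations only (positive transcendence defect; open for `d ≥ 4`), modulo the printed Knaf–Kuhlmann theorem in its
general form.  Structural bookkeeping, counted 0.
-/

noncomputable section

set_option linter.dupNamespace false -- mandated namespace of this single-conjunct summit

open IsLocalRing AlgebraicGeometry CategoryTheory
open Literature.AlgebraicGeometry.Resolution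

namespace Summit.ResolutionOfSingularities.ResolutionOfSingularities.Theorems.RadicialJung.CleanModels

universe u v

/-- **The general form implies the special form** `KnafKuhlmann2005_Thm11_monomialForm` (separable ALGEBRAIC residue field extension; hand-2 g2,
✓ p793207): a separable algebraic extension is separably generated with the EMPTY transcendence basis.  Sanity link between the two typings of
Knaf–Kuhlmann 2005 Thm. 1.1; in particular every consumer of `…_monomialForm` is served by a discharge of `…_monomialFormSepGen`.
[cite: KnafKuhlmann2005, Thm. 1.1] -/
theorem knafKuhlmann2005_monomialForm_of_monomialFormSepGen (h : Literature.AlgebraicGeometry.Resolution.KnafKuhlmann2005_Thm11_monomialFormSepGen.{u, v}) :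
    Literature.AlgebraicGeometry.Resolution.KnafKuhlmann2005_Thm11_monomialForm.{u, v} := by
  intro k K _ _ _ hfg O hk htd hsep Z hZ
  refine h k K hfg O hk htd ?_ Z hZ
  letI : Algebra k (IsLocalRing.ResidueField O) :=
    ((IsLocalRing.residue O).comp ((algebraMap k K).codRestrict O hk)).toAlgebra
  haveI : Algebra.IsSeparable k (IsLocalRing.ResidueField O) := hsep
  refine ⟨∅, ?_, ?_⟩
  · have hinj : Function.Injective (algebraMap k (IsLocalRing.ResidueField O)) := (algebraMap k _).injective
    have ind : AlgebraicIndependent k ((↑) : (∅ : Finset (IsLocalRing.ResidueField O)) → IsLocalRing.ResidueField O) :=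
      algebraicIndependent_empty_type_iff.mpr hinj
    rw [ind.isTranscendenceBasis_iff_isAlgebraic, Set.range_eq_empty, Algebra.adjoin_empty]
    exact (Subalgebra.algebra_isAlgebraic_bot_left_iff hinj).mpr inferInstance
  · exact Algebra.isSeparable_tower_top_of_isSeparable k _ _

/-! ## The transfer along the ground field -/

/-- **Ground-field descent of a monomializing model.**  Let `k₀ → k → K` be fields, `O` a valuation ring of `K` containing `k`, `A = k[S]` a
`k`-subalgebra of `K` (`S` finite), `k = k₀(T)` (`T` finite), and `A₀' ⊆ O` a finitely generated `k₀`-subalgebra of `K` containing `S` and (the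
images of) `T`, whose local ring at the centre of `O` is regular with regular system of parameters `a` in which every non-zero `z ∈ Z` is an
`𝒪`-monomial.  Then `A' := k[A₀']` is a finitely generated `k`-subalgebra with `A ⊆ A' ⊆ O` and `locAtCentre A' O = locAtCentre A₀' O` (the
constants are quotients of elements of `k₀[T] ⊆ A₀'` by elements of value `1`), so the `hMono` conclusion of ✓ `cleanModels_dim_of_localMonomialization`
holds for `A` over `k`, witnessed by `A'`. [folklore] -/
theorem localMonomialization_of_groundField_descent
    (k₀ k K : Type) [Field k₀] [Field k] [Field K] [Algebra k₀ k] [Algebra k K] [Algebra k₀ K] [IsScalarTower k₀ k K]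
    (O : ValuationSubring K) (hk : ∀ c : k, algebraMap k K c ∈ O)
    (A : Subalgebra k K) (S : Finset K) (hS : Algebra.adjoin k (S : Set K) = A)
    (T : Finset k) (hT : IntermediateField.adjoin k₀ (T : Set k) = ⊤)
    (Z : Finset K)
    (A₀' : Subalgebra k₀ K) (hA₀'O : A₀'.toSubring ≤ O.toSubring) (hA₀'fg : A₀'.FG)
    (hSA₀' : ∀ z ∈ S, z ∈ A₀') (hTA₀' : ∀ c ∈ T, algebraMap k K c ∈ A₀')
    (hreg : IsRegularLocalRing (locAtCentre A₀'.toSubring O)) {e : ℕ} (a : Fin e → ↥(locAtCentre A₀'.toSubring O))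
    (hspan : Ideal.span (Set.range a) = IsLocalRing.maximalIdeal ↥(locAtCentre A₀'.toSubring O))
    (hdim : ringKrullDim ↥(locAtCentre A₀'.toSubring O) = (e : WithBot ℕ∞))
    (hmono : ∀ z ∈ Z, z ≠ 0 → ∃ (v : ↥(locAtCentre A₀'.toSubring O)) (μ : Fin e → ℕ), IsUnit v ∧
      z = (v : K) * ∏ i, ((a i : ↥(locAtCentre A₀'.toSubring O)) : K) ^ (μ i)) :
    ∃ (A' : Subalgebra k K), A'.toSubring ≤ O.toSubring ∧ A ≤ A' ∧ A'.FG ∧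
    ∃ (_ : IsRegularLocalRing (locAtCentre A'.toSubring O)) (e : ℕ) (a : Fin e → ↥(locAtCentre A'.toSubring O)),
      Ideal.span (Set.range a) = IsLocalRing.maximalIdeal ↥(locAtCentre A'.toSubring O) ∧
      ringKrullDim ↥(locAtCentre A'.toSubring O) = (e : WithBot ℕ∞) ∧
      ∀ z ∈ Z, z ≠ 0 → ∃ (v : ↥(locAtCentre A'.toSubring O)) (μ : Fin e → ℕ), IsUnit v ∧
        z = (v : K) * ∏ i, ((a i : ↥(locAtCentre A'.toSubring O)) : K) ^ (μ i) := by
  classical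
  obtain ⟨G, hG⟩ := hA₀'fg
  -- the `k`-model `A' := k[G] = k[A₀']`
  let A' : Subalgebra k K := Algebra.adjoin k (G : Set K)
  have hGA₀' : ∀ g ∈ (G : Set K), g ∈ A₀' := fun g hg => (hG ▸ Algebra.subset_adjoin hg : g ∈ A₀')
  have hA₀'A' : ∀ x ∈ A₀', x ∈ A' := by
    intro x hx
    rw [← hG] at hx
    have hle : Algebra.adjoin k₀ (G : Set K) ≤ (Algebra.adjoin k (G : Set K)).restrictScalars k₀ := by
      refine Algebra.adjoin_le ?_
      intro g hg
      change g ∈ Algebra.adjoin k (G : Set K)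
      exact Algebra.subset_adjoin hg
    exact hle hx
  have hA'cl : A'.toSubring = Subring.closure (Set.range (algebraMap k K) ∪ (G : Set K)) :=
    Algebra.adjoin_eq_ring_closure _
  -- `A' ⊆ O`
  have hA'O : A'.toSubring ≤ O.toSubring := by
    rw [hA'cl, Subring.closure_le]
    rintro y (⟨c, rfl⟩ | hy)
    · exact hk c
    · exact hA₀'O (hGA₀' y hy)
  -- `A ≤ A'`
  have hAA' : A ≤ A' := by
    rw [← hS]
    exact Algebra.adjoin_le fun z hz => hA₀'A' z (hSA₀' z hz)
  -- `k₀[T] → A₀'`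
  have hpoly : ∀ q ∈ Algebra.adjoin k₀ (T : Set k), algebraMap k K q ∈ A₀' := by
    intro q hq
    induction hq using Algebra.adjoin_induction with
    | mem t ht => exact hTA₀' t ht
    | algebraMap c =>
      rw [← IsScalarTower.algebraMap_apply]
      exact A₀'.algebraMap_mem c
    | add x y _ _ hx hy =>
      rw [map_add]
      exact add_mem hx hy
    | mul x y _ _ hx hy =>
      rw [map_mul]
      exact mul_mem hx hy
  -- the constants lie in `locAtCentre A₀' O`
  have hconst : ∀ c : k, algebraMap k K c ∈ locAtCentre A₀'.toSubring O := by
    intro c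
    have hc : c ∈ IntermediateField.adjoin k₀ (T : Set k) := by
      rw [hT]
      exact IntermediateField.mem_top
    obtain ⟨r, hr, s, hs, rfl⟩ := IntermediateField.mem_adjoin_iff_div.mp hc
    by_cases hs0 : s = 0
    · rw [hs0, div_zero, map_zero]
      exact zero_mem _
    · rw [map_div₀]
      refine ⟨algebraMap k K r, hpoly r hr, algebraMap k K s, hpoly s hs, ?_, rfl⟩
      -- `v(s) = 1` on the `k`-trivial valuation ring
      have h1 : O.valuation (algebraMap k K s) ≤ 1 := (O.valuation_le_one_iff _).mpr (hk s)
      have h2 : (O.valuation (algebraMap k K s))⁻¹ ≤ 1 := by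
        rw [← map_inv₀, ← map_inv₀]
        exact (O.valuation_le_one_iff _).mpr (hk s⁻¹)
      have hs0' : O.valuation (algebraMap k K s) ≠ 0 :=
        (map_ne_zero O.valuation).mpr ((map_ne_zero (algebraMap k K)).mpr hs0)
      exact le_antisymm h1 ((inv_le_one₀ (zero_lt_iff.mpr hs0')).mp h2)
  -- `A' ≤ locAtCentre A₀' O`, hence the two local rings coincide
  have hA'loc : A'.toSubring ≤ locAtCentre A₀'.toSubring O := by
    rw [hA'cl, Subring.closure_le]
    rintro y (⟨c, rfl⟩ | hy)
    · exact hconst c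
    · exact le_locAtCentre A₀'.toSubring O (hGA₀' y hy)
  have hEq : locAtCentre A'.toSubring O = locAtCentre A₀'.toSubring O :=
    le_antisymm ((locAtCentre_mono O hA'loc).trans (locAtCentre_locAtCentre A₀'.toSubring O).le)
      (locAtCentre_mono O fun x hx => hA₀'A' x hx)
  refine ⟨A', hA'O, hAA', ⟨G, rfl⟩, ?_⟩
  rw [hEq]
  exact ⟨hreg, e, a, hspan, hdim, hmono⟩

/-! ## The Abhyankar column over a subfield of the ground field -/

/-- **Local monomialization at a place that is Abhyankar with separably generated residue field over a SUBFIELD `k₀` of the ground field, from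
Knaf–Kuhlmann 2005 Thm. 1.1 (general form).**  Let `k₀ → k → K` be fields with `k = k₀(T)` finitely generated over `k₀`, `O` a valuation ring of
`K`, `A ⊆ O` a finitely generated `k`-subalgebra with `Frac A = K`, and suppose `O` is Abhyankar over `k₀` with `κ(O)/k₀` separably generated.
Then, granted `KnafKuhlmann2005_Thm11_monomialFormSepGen`, every finite `Z ⊆ A` is monomialized along `O` on a finitely generated `A ⊆ A' ⊆ O`
regular at the centre — the `hMono` conclusion over `k`, although `κ(O)/k` may be inseparable.  Proof: the fact over `k₀` with
`Z ∪ S ∪ T` (`S` generators of `A`), then `localMonomialization_of_groundField_descent`. [cite: KnafKuhlmann2005, Thm. 1.1] -/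
theorem localMonomialization_at_abhyankarPlace_of_subfield (hKKg : Literature.AlgebraicGeometry.Resolution.KnafKuhlmann2005_Thm11_monomialFormSepGen.{0, 0})
    (k₀ k K : Type) [Field k₀] [Field k] [Field K] [Algebra k₀ k] [Algebra k K] [Algebra k₀ K] [IsScalarTower k₀ k K]
    (T : Finset k) (hT : IntermediateField.adjoin k₀ (T : Set k) = ⊤)
    (O : ValuationSubring K) (A : Subalgebra k K) (hAO : A.toSubring ≤ O.toSubring) (hAfg : A.FG)
    (hfrac : IsFractionRing A K)
    (hk₀ : ∀ c : k₀, algebraMap k₀ K c ∈ O) (htd₀ : transcendenceDefect k₀ O hk₀ = 0)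
    (hsep₀ : letI : Algebra k₀ (IsLocalRing.ResidueField O) :=
        ((IsLocalRing.residue O).comp ((algebraMap k₀ K).codRestrict O hk₀)).toAlgebra
      ∃ s : Finset (IsLocalRing.ResidueField O),
        IsTranscendenceBasis k₀ ((↑) : s → IsLocalRing.ResidueField O) ∧
        Algebra.IsSeparable (IntermediateField.adjoin k₀ (s : Set (IsLocalRing.ResidueField O))) (IsLocalRing.ResidueField O))
    (Z : Finset K) (hZ : ∀ z ∈ Z, z ∈ A) :
    ∃ (A' : Subalgebra k K), A'.toSubring ≤ O.toSubring ∧ A ≤ A' ∧ A'.FG ∧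
    ∃ (_ : IsRegularLocalRing (locAtCentre A'.toSubring O)) (e : ℕ) (a : Fin e → ↥(locAtCentre A'.toSubring O)),
      Ideal.span (Set.range a) = IsLocalRing.maximalIdeal ↥(locAtCentre A'.toSubring O) ∧
      ringKrullDim ↥(locAtCentre A'.toSubring O) = (e : WithBot ℕ∞) ∧
      ∀ z ∈ Z, z ≠ 0 → ∃ (v : ↥(locAtCentre A'.toSubring O)) (μ : Fin e → ℕ), IsUnit v ∧
        z = (v : K) * ∏ i, ((a i : ↥(locAtCentre A'.toSubring O)) : K) ^ (μ i) := by
  classical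
  have hk : ∀ c : k, algebraMap k K c ∈ O := fun c => hAO (A.algebraMap_mem c)
  obtain ⟨S, hS⟩ := hAfg
  -- the images `T'` of the field generators of `k/k₀`
  let T' : Finset K := T.image (algebraMap k K)
  -- `K` is finitely generated over `k₀`
  have hKfg : (⊤ : IntermediateField k₀ K).FG := by
    obtain ⟨S₁, hS₁⟩ := intermediateField_top_fg A ⟨S, hS⟩ hfrac
    refine ⟨T' ∪ S₁, ?_⟩
    apply le_antisymm le_top
    -- `range (k → K) ⊆ k₀(T')`
    have hrange : Set.range (algebraMap k K) ⊆ (IntermediateField.adjoin k₀ (↑(T' ∪ S₁) : Set K) : Set K) := by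
      rintro _ ⟨c, rfl⟩
      have hc : c ∈ IntermediateField.adjoin k₀ (T : Set k) := by rw [hT]; exact IntermediateField.mem_top
      obtain ⟨r, hr, s, hs, rfl⟩ := IntermediateField.mem_adjoin_iff_div.mp hc
      have hpoly : ∀ q ∈ Algebra.adjoin k₀ (T : Set k),
          algebraMap k K q ∈ IntermediateField.adjoin k₀ (↑(T' ∪ S₁) : Set K) := by
        intro q hq
        induction hq using Algebra.adjoin_induction with
        | mem t ht =>
          refine IntermediateField.subset_adjoin _ _ ?_
          rw [Finset.coe_union, Finset.coe_image]
          exact Or.inl ⟨t, ht, rfl⟩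
        | algebraMap c =>
          rw [← IsScalarTower.algebraMap_apply]
          exact IntermediateField.algebraMap_mem _ c
        | add x y _ _ hx hy =>
          rw [map_add]
          exact add_mem hx hy
        | mul x y _ _ hx hy =>
          rw [map_mul]
          exact mul_mem hx hy
      rw [map_div₀]
      exact div_mem (hpoly r hr) (hpoly s hs)
    intro x _
    have hx : x ∈ (⊤ : IntermediateField k K) := IntermediateField.mem_top
    rw [← hS₁] at hx
    change x ∈ (IntermediateField.adjoin k (S₁ : Set K)).toSubfield at hx
    rw [IntermediateField.adjoin_toSubfield] at hx
    refine (Subfield.closure_le (t := (IntermediateField.adjoin k₀ (↑(T' ∪ S₁) : Set K)).toSubfield)).mpr ?_ hx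
    refine Set.union_subset hrange fun y hy => IntermediateField.subset_adjoin _ _ ?_
    rw [Finset.coe_union]
    exact Or.inr hy
  -- Knaf–Kuhlmann over `k₀` with `Z ∪ S ∪ T'`
  let Z' : Finset K := Z ∪ S ∪ T'
  have hZ'O : ∀ z ∈ Z', z ∈ O := by
    intro z hz
    rcases Finset.mem_union.mp hz with hz | hz
    · rcases Finset.mem_union.mp hz with hz | hz
      · exact hAO (hZ z hz)
      · exact hAO (hS ▸ Algebra.subset_adjoin hz : z ∈ A)
    · obtain ⟨c, -, rfl⟩ := Finset.mem_image.mp hz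
      exact hk c
  obtain ⟨A₀', hA₀'fg, hA₀'O, -, hZA₀', hreg, d, a, hspan, hdim, hmono⟩ := hKKg k₀ K hKfg O hk₀ htd₀ hsep₀ Z' hZ'O
  refine localMonomialization_of_groundField_descent k₀ k K O hk A S hS T hT Z A₀' hA₀'O hA₀'fg
    (fun z hz => hZA₀' z (Finset.mem_union_left _ (Finset.mem_union_right _ hz)))
    (fun c hc => hZA₀' _ (Finset.mem_union_right _ (Finset.mem_image_of_mem _ hc))) hreg a hspan hdim
    (fun z hz hz0 => hmono z (Finset.mem_union_left _ (Finset.mem_union_left _ hz)) hz0)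

end Summit.ResolutionOfSingularities.ResolutionOfSingularities.Theorems.RadicialJung.CleanModels

end
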